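import Mathlib
import HarnessLib
import HarnessLib.Audit
import Summits.SmoothPoincare4.Statement
import Literature.Geometry.Lorentzian.LeviCivita
import Literature.Geometry.Riemannian.ConformallyFlat
import Literature.Geometry.Riemannian.WeylEnergy
import HarnessLib.Audit.Status.Attr

/-!
Route: BachCriticalElement

DORMANT since 2026-08-22T15:47:01Z (reconciler: no traction for 5.5 d (last activity item-evidence-added at 2026-08-17T04:14:07Z); parked, not closed — `ledger route dormant route-SmoothPoincare4-BachCriticalElement --off` to reactivate) — unstaffed, not closed; items shared with open routes are served there. `ledger route dormant <id> --off` reactivates.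

# Route BachCriticalElement — Weyl-minimal fake sphere — a critical-element programme (CQY
Weyl-energy compactness + Bach-flat/Einstein rigidity at chi = 2)

It suffices to show X = X₁ ∧ P, realising card bach-critical-element (spine). X₁ (target
PscSpheresStandard, "Yamabe-positive homotopy
4-spheres are standard"): every smooth homotopy 4-sphere M that carries a Riemannian metric of
positive scalar curvature is diffeomorphic to
S⁴. P (crux PscOnHomotopySpheres, shared with route PIC): every smooth homotopy 4-sphere carries
such a metric. X₁ is the deliverable of a
Kenig–Merle critical-element programme run on the conformally invariant Weyl energy 𝒲[g] = ∫|W|² in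
the Yamabe-positive cone: threshold =
Chang–Gursky–Yang's 32π² = 16π²χ, profile decomposition = Chang–Qing–Yang's Bach-flat bubble tree,
critical element = a 𝒲-minimising PSC
metric on an exotic sphere, Liouville step = rigidity of Yamabe-positive Bach-flat (in particular
Einstein) metrics at χ = 2, σ = 0, π₁ = 1.
The two mechanism cruxes (WeylInfimumAttained, WeylMinimiserRigidity) are filed informally at open
and typed the day `weylEnergy`
(defn-weylEnergy) lands; the typed cruxes at open are the Einstein base case of the Liouville step
and P.
Lean: `(∀ (M : Type) [TopologicalSpace M] [T2Space M] [SecondCountableTopology M] [ChartedSpace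
(EuclideanSpace ℝ (Fin 4)) M] [IsManifold (𝓡 4) ∞ M], M ≃ₕ Metric.sphere (0 : EuclideanSpace ℝ (Fin
5)) 1 → (∃ g : Literature.Geometry.Lorentzian.PseudoRiemannianMetric (𝓡 4) ∞ (EuclideanSpace ℝ (Fin
4)) (TangentSpace (𝓡 4) : M → Type _), ∃ _ : g.HasLeviCivita, g.IsRiemannian ∧ ∀ x, 0 <
g.scalarCurvature x) → Nonempty (M ≃ₘ⟮𝓡 4, 𝓡 4⟯ Metric.sphere (0 : EuclideanSpace ℝ (Fin 5)) 1)) ∧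
(∀ (M : Type) [TopologicalSpace M] [T2Space M] [SecondCountableTopology M] [ChartedSpace
(EuclideanSpace ℝ (Fin 4)) M] [IsManifold (𝓡 4) ∞ M], M ≃ₕ Metric.sphere (0 : EuclideanSpace ℝ (Fin
5)) 1 → ∃ g : Literature.Geometry.Lorentzian.PseudoRiemannianMetric (𝓡 4) ∞ (EuclideanSpace ℝ (Fin
4)) (TangentSpace (𝓡 4) : M → Type _), ∃ _ : g.HasLeviCivita, g.IsRiemannian ∧ ∀ x, 0 <
g.scalarCurvature x)`

## Assembly
Pure logic (proved in the planner's Sketch.lean, two lines: `intro hP hS M _ _ _ _ _ e; exact hS M e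
(hP M e)`): SmoothPoincare4 unfolds to
∀ M (T2, second countable) (atlas) (smooth), M ≃ₕ S⁴ → Nonempty (M ≃ₘ S⁴); given M and e, P supplies
a PSC metric and X₁ the diffeomorphism.
No packaging facts are needed because every item uses the summit's own binder.

Rationale: WHY THIS LINE. Instead of constructing a good metric on an unknown Σ (routes PIC, card
weyl-budget-cork-regluing), let the worst exotic sphere select its
own best metric and show that metric cannot exist: the Kenig–Merle road map (KenigMerle2006:
variational threshold, profile decomposition,
minimal blow-up object, rigidity) transplanted with an explicit dictionary to 4-d conformal
geometry, where every analytic station is in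
print for the critical class — the threshold theorem ChangGurskyYang2003 Thms A/B
(arXiv:math/0309287 pp.1–2: Y > 0 and ∫|W|² < 16π²χ ⇒
S⁴ or RP⁴; equality forces Bach-flatness), the neck analysis, bubble tree, gap and finiteness
theorems of ChangQingYang2007 (arXiv:math/0508621
p.2, Thms A/B, built on TianViaclovsky2004, TianViaclovsky2005, Anderson2005), and Gauss–Bonnet at χ
= 2 (∫σ₂ = 16π² − 𝒲/4), which makes
one number parametrise the problem and confines a critical element to the window 𝒲 ∈ (32π², 64π²)
where ∫σ₂ > 0 or to 𝒲 ≥ 64π² where no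
compactness is known. Imported areas: dispersive-PDE concentration-compactness (the template),
fourth-order conformally invariant elliptic
theory (Bach-flat metrics), Einstein-metric rigidity (Besse1987 §0.32, Gursky2000, Brendle2010,
doi:10.1007/s002220000097). What it does that
prior routes do not: PIC asks for a pointwise curvature cone on Σ and runs Ricci flow; here no
metric is constructed, the object is Σ's own
Weyl-minimiser, and the Lean-closable statements are Liouville theorems for ONE conformally
invariant elliptic system on the simplest topology,
starting with the typable Einstein case (kill-able by a single non-round Einstein metric on S⁴).
Negatives index: empty.

RANKED CRUXES. #0 PscSpheresStandard (target) — every smooth homotopy 4-sphere (summit binder: T2,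
second countable, C^∞ atlas on ℝ⁴, M ≃ₕ S⁴) carrying a Riemannian metric with a Levi-Civita
connection and everywhere positive scalar curvature is diffeomorphic to S⁴ — the deliverable X₁ of
the critical-element programme (card cruxes E + R), the node that the two-layer plan splits into
WeylInfimumAttained → WeylMinimiserRigidity once weylEnergy lands. [deps: EinsteinRigidity,
PscOnHomotopySpheres] [difficulty: open-problem] (why it might fail: It is SPC4 on Yamabe-positive
spheres: false iff an exotic homotopy 4-sphere carries a PSC metric; the programme needs
WeylInfimumAttained (no ε-regularity for minimising sequences; no compactness at 𝒲 ≥ 64π²) and a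
Liouville step containing Einstein uniqueness on S⁴.) [ChangGurskyYang2003, ChangQingYang2007,
KenigMerle2006, arXiv:math/0404251]
#2 EinsteinRigidity (crux) — the Einstein base case of the Liouville step (card crux R restricted to
Einstein metrics, which are Bach-flat and Yamabe-positive when Λ > 0): on a smooth homotopy 4-sphere
M, every Riemannian metric g with Levi-Civita connection and Ric_g = Λ·g for some Λ > 0 is locally
conformally flat (hence, by Kuiper — proved in tree — M ≅ S⁴ and g has constant curvature). Known
rungs: W⁺ ≡ 0 (Hitchin, Besse1987 13.30), nonnegative isotropic curvature (MicallefWang1993,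
Brendle2010), sectional-curvature pinching (Yang 2000 doi:10.1007/s002220000097, Cui–Sun
doi:10.1007/s00229-020-01217-y), W⁺ small with the sphere's Einstein constant (Gursky2000), and
local rigidity of the round metric (Koiso, Besse1987 12.H). [difficulty: open-problem] (why it might
fail: It contains uniqueness of the round Einstein metric on S⁴ (Besse1987 §0.32: no manifold, not
even S⁴, is known to carry exactly one Einstein structure); Böhm built non-round Einstein metrics on
S⁵–S⁹ (Bohm1998); one non-round Λ>0 Einstein metric on S⁴ refutes it without touching SPC4.)
[Besse1987, Bohm1998, Gursky2000, Brendle2010, MicallefWang1993, doi:10.1007/s002220000097,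
ChangGurskyYang2003]
#3 PscOnHomotopySpheres (crux) — every smooth homotopy 4-sphere (summit binder) carries a Riemannian
metric with a Levi-Civita connection and everywhere positive scalar curvature (card crux P; the same
content as route PIC's PicPscV2, stmt-SmoothPoincare4-0442, restated with the summit binder M ≃ₕ S⁴
instead of `HomotopySphere 4` so that no fact-bearing topology file enters this route's import
cone). Without it the programme proves X₁ only; its refutation refutes SPC4. [difficulty:
open-problem] (why it might fail: PSC on a GIVEN smooth homotopy 4-sphere is open:
Gromov–Lawson/Stolz give PSC in dim 4 only up to homeomorphism (KumarSen2025 Obs. 9); Σ comes from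
S⁴ by codimension-2 surgeries where PSC surgery fails; an exotic Σ may carry an unknown
obstruction.) [KumarSen2025, arXiv:2501.01113, Hoelzel2016, SchoenYau1979, Hamilton1997]
#9 EinsteinSpheresStandard (support) — glue for the Einstein rung, provable now: EinsteinRigidity
implies that a smooth homotopy 4-sphere carrying a Λ>0 Einstein metric is diffeomorphic to S⁴ — from
compactness (Literature.Topology.FourManifolds.compactSpace_of_homotopyEquiv_sphere_four_holds) and
simple connectivity (simplyConnectedSpace_of_homotopyEquiv_sphere_four with
simplyConnectedSpace_sphere_four_holds) of M ≃ₕ S⁴ and Kuiper's theorem in dimension 4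
(Literature.Geometry.Riemannian.kuiper_four applied to kuiper_holds), ≈ 10 lines in a Theorems file
importing those proof files. [difficulty: provable-now] [Kuiper1949, Besse1987, HatcherAT2002]

TWO-LAYER PLAN. Foreseen glued splits (filed by `route edit --split` in tenure, not now). (a) The
critical-element split of the target, the day defn-weylEnergy
lands and the two informal cruxes get signatures: PscSpheresStandard ⇐ WeylInfimumAttained →
WeylMinimiserRigidity → PscSpheresStandard (glue
provable from Kuiper, proved in tree: the attained minimiser is LCF, so M ≅ S⁴). (b) If
WeylInfimumAttained stalls or is refuted by bubbling:
resplit into the CQY dichotomy — "attained, or a minimising sequence converges to a Bach-flat Y ≥ 0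
orbifold body plus Bach-flat ALE bubbles
regluing to M" — plus conjecture R in full (Bach-flat + scal > 0 on a homotopy 4-sphere, and its
orbifold/ALE versions ⇒ conformally flat;
needs IsBachFlat, definition request filed). (c) EinsteinRigidity ⇐ (positive sectional curvature
case, the Yang/Cui–Sun pinching ladder) →
(W⁺ L²-small case, Gursky2000) → general; k ≤ 3, depth 1.

KILL CRITERIA. PscOnHomotopySpheres refuted (a homotopy 4-sphere without PSC) ⇒ that Σ is exotic,
¬SPC4: close `refuted:PscOnHomotopySpheres` together with
the problem (same kill as PIC's PicPscV2). EinsteinRigidity refuted by a non-round Λ>0 Einstein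
metric on the STANDARD S⁴ ⇒ the Liouville step
loses its base case: close `refuted:EinsteinRigidity` unless the witness is 𝒲-unstable among PSC
metrics (then pivot: keep only the minimal
form WeylMinimiserRigidity, whose content is instability/non-existence of 𝒲-minimisers on exotic
spheres, and say so in the thesis). A theorem
"𝒲-minimising sequences in the PSC cone of some 4-manifold with Y > 0 must bubble with energy loss"
does not kill (branch (b) of the plan). SPC4
proved elsewhere moots the route; X₁ proved elsewhere (e.g. via PIC + Hamilton) leaves only the
shared crux P.

NOT DECOMPOSED YET. Conjecture R in full generality and its orbifold/ALE versions (layer 2, branch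
(b)); the Yamabe-degeneration issue (Y[g_k] → 0 along
𝒲-minimising PSC sequences — CQY needs ∫σ₂ ≥ a₀ > 0, i.e. 𝒲 ≤ 64π² − 4a₀ at χ = 2; a yamabeConstant
definition is NOT requested yet, the
PSC-cone phrasing avoids it); ε-regularity for minimising (not Bach-flat) sequences — the missing
lemma of crux E; the flow alternative (Bach
flow: short-time existence only, Bahuaud–Helliwell arXiv:1010.4287; fourth-order flows with a
Yamabe-positivity constraint, Bour
arXiv:1012.0342); the Gauss–Bonnet bookkeeping support (∫σ₂ dv = 16π² − 𝒲/4 on a homotopy 4-sphere;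
CGY A ⇔ 𝒲 < 32π²; on an exotic Σ every
PSC metric has 𝒲 > 32π² strictly by Thms A+B) — filed as support once weylEnergy and a
Chern–Gauss–Bonnet fact exist; the negative reading
(exotic ⇒ no PSC metric) as ¬-items; named facts CGY Thm A / CQY Thms A, B as cite items (to live in
a SEPARATE facts file, not in the
definition file, for cone hygiene).

CHEAPEST FALSIFIER. One non-round Einstein metric with Λ > 0 on S⁴ kills EinsteinRigidity (and R,
and the card's Liouville step) at once. Checks a refuter runs
first: (i) cohomogeneity one — Böhm's construction (Bohm1998, Invent. Math. 134) yields non-round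
Einstein metrics on S⁵,…,S⁹ but needs two
non-trivial sphere factors, unavailable on S⁴; the SO(3)-irreducible action on S⁴ ⊂ Sym²₀(ℝ³) and
the doubly-warped ansätze (Qiu Shi Wang 2026,
arXiv:2606.05519, "doubly warped product Einstein metrics on spheres" — check which spheres) are the
places to look; (ii) numerical Einstein
solvers on S⁴ ansätze (Ricci-flow / Newton searches à la Headrick–Wiseman). What I ran (2026-08-15):
zbMATH 'Einstein metrics four-sphere
uniqueness' (1 hit, irrelevant), 'inhomogeneous Einstein metrics low-dimensional spheres' (Bohm1998
only), 'Rigidity of Einstein 4-manifolds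
with positive curvature' (Yang 2000, Fine–Krasnov–Singer arXiv:1910.09790 local rigidity, Zhang
2020), 'cohomogeneity one Einstein metrics
spheres' (6, none on S⁴); Besse1987 §0.32 read (PDF p.114): open in 1987; no S⁴ example surfaced —
not refuted by lookup.

NUMBERS. |W|² = W_ijkl W^ijkl, the (0,4)-norm (ChangGurskyYang2003 Remark 2, p.2).
Chern–Gauss–Bonnet: ∫(¼|W|² + σ₂(A)) dv = 8π²χ, so on a homotopy
4-sphere ∫σ₂ = 16π² − 𝒲/4. Thresholds at χ = 2: 𝒲 < 32π² = 16π²χ ⇒ S⁴/RP⁴ (CGY Thm A); 𝒲 = 32π² on a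
non-S⁴ ⇒ CP² or S³×S¹-quotient
conformally (Thms B/C), impossible at χ = 2, π₁ = 1, so an exotic Σ has 𝒲 > 32π² for every PSC
metric; 𝒲 < 64π² ⇔ ∫σ₂ > 0 ⇒ a conformal
metric with Ric > 0 (Chang–Gursky–Yang, Annals 155 (2002)); CQY finiteness (Thm B) needs Y > 0, 𝒲 ≤
Λ₀ and ∫σ₂ ≥ a₀ > 0, i.e. 𝒲 ≤ 64π² − 4a₀;
CQY gap (Thm A): Bach-flat, Y > 0, ∫σ₂ ≥ (1 − ε)16π² with ε < ε₀(Λ₀) ⇒ conformally round. Round S⁴: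
𝒲 = 0, Y(S⁴) = 8√6·π ≈ 61.6.
Items at open: 5 typed (target, 2 cruxes, 1 support, assembly) + 2 informal cruxes filed right after
open = 7.

DEFINITION REQUESTS. - weylEnergy (EXISTING request defn-weylEnergy, topic
Literature/Geometry/Riemannian, claimed 2026-08-15): needed to type WeylInfimumAttained
  and WeylMinimiserRigidity (intended signatures are written into their informal texts; summit
binder; `g.weylEnergy : ℝ≥0∞`).
- IsBachFlat (NEW, topic Literature/Geometry/Riemannian): Bach tensor B_ij = ∇ᵏ∇ˡW_kijl + ½Rᵏˡ
W_kijl = 0 (ChangGurskyYang2003 (0.7); Besse1987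
  4.76–4.77), equivalently criticality of weylEnergy under compactly supported variations;
conformally invariant in dim 4, Einstein ⇒
  Bach-flat (sanity lemmas, not part of the def); fact-free file. Needed for conjecture R / branch
(b).
- Cite facts wanted later (separate facts file): CGY 2003 Thm A (dim 4, verbatim); CQY 2007 Thms A
(gap) and B (finiteness); Chang–Gursky–Yang
  2002 (Y > 0 ∧ ∫σ₂ > 0 ⇒ conformal Ric > 0).

Novelty: Searches (2026-08-15; local searchd down, OpenAlex budget exhausted, arXiv 429 — zbMATH + held texts
+ citation graph used): `lit search --source
zbmath` ×9: 'Einstein metrics four-sphere uniqueness' (1), 'Einstein four-manifold positive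
sectional curvature sphere rigidity' (1: Cui–Sun
2021), 'Bach-flat positive Yamabe rigidity' (10: ChangGurskyYang2003, Kim arXiv:1001.2759, Fu–Peng
arXiv:1707.07236, Huang arXiv:1707.00902, Bour
arXiv:1012.0342 …), 'cohomogeneity one Einstein metrics spheres' (6), 'inhomogeneous Einstein
metrics low-dimensional spheres' (Bohm1998),
'Einstein constants of the sphere four-manifolds' (Gursky2000), 'Einstein manifolds positive
isotropic curvature locally symmetric'
(Brendle2010), 'conformal gap finiteness theorem' (ChangQingYang2007), 'moduli spaces critical
Riemannian metrics' / 'orbifold compactness'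
(TianViaclovsky2005, Anderson2005, TianViaclovsky2004); `lit frontier SmoothPoincare4 --since 2020`
(30 rows, all topological/gauge-theoretic,
none variational-conformal); `lit bridges SmoothPoincare4 --cross any` (30 rows, nothing joining
CGY/CQY to homotopy spheres); `lit galaxy
search --star all` ×3 ('Einstein metrics on the four-sphere', 'uniqueness of the Einstein metric on
the 4-sphere', 'minimizing the Weyl
functional': 0 hits, 2 saturated); read: arXiv:math/0309287 pp.1–2, arXiv:math/0508621 p.2,
Besse1987 §0.32 and p.118; `ledger negatives` (0).
Nearest prior art found: ChangQingYang2007 = arXiv:math/0508621 (bubble tree, gap, finiteness f  [refs: 10.1007/s002220000097, 1001.2759, 1707.07236, 1707.00902, 1012.0342, math/0309287, math/0508621, math/0404251, doi:10.1007/s002220000097, ChangGurskyYang2003, Bohm1998, Gursky2000, Brendle2010, ChangQingYang2007, TianViaclovsky2005, Anderson2005, TianViaclovsky2004, Besse1987, Kobayashi1985, KenigMerle2006]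

Barriers (technique_class: conformal-critical-element): - technique_class: conformal-critical-element
- Literature.Barriers.SmoothPoincare4.HCobordismBarrierFour: evaded by mechanism — no h-cobordism
step; the diffeomorphism comes from Kuiper's development (proved in tree) applied to a conformally
flat minimiser, or from CGY Thm A (conformal PDE + Margerin/Hamilton) on the pieces.
- Literature.Barriers.SmoothPoincare4.ProjectiveRigidityBarrierFour: not engaged — CGY's alternative
conclusion RP⁴ never occurs at π₁ = 1 and nothing is claimed about free quotients.
- Literature.Barriers.SmoothPoincare4.SmallExoticaBarrier: evaded by scope, forced by Gauss–Bonnet —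
the threshold theorem only ever outputs S⁴/RP⁴ (χ ≤ 2 under the inequality); nothing is claimed at
b₂ ≥ 1.
- Literature.Barriers.SmoothPoincare4.TopologicalBarrierFour: does not apply — w(Σ) = inf{𝒲 : scal >
0} is a smooth, not a homotopy, invariant; it is bounded below by compactness arguments, never
computed from topological data.
- Literature.Barriers.SmoothPoincare4.StableBarrierFour: does not apply — the line never stabilises;
connected sum with S²×S² changes χ and the threshold 16π²χ, so the argument is intrinsically
unstable-range.
- Literature.Barriers.SmoothPoincare4.HCobordismInvariantBarrierFour: does not apply — no
h-cobordism-invariant detector is used; the minimiser is a metric on Σ itself.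
- Literature.Barriers.SmoothPoincare4.GaugeSumBarrierFour: does not apply — no
Donaldson/Seiberg–Witten invariant (blind at b⁺ = 0) is invoked; the elliptic system is the co

Novelty grade: new-combination — Refuter route-review 2026-08-15 (memo review-BachCriticalElement.md attached as route evidence). Grade new-combination: a Kenig–Merle concentration-compactness/rigidity programme transplanted onto the conformally invariant Weyl energy in the Yamabe-positive cone of a homotopy 4-sphere, with CGY2003/ (refuter refuter-rreview-route-MatrixMultiplicati-88cb055c-g2-0, 2026-08-15T14:48:27Z; prior: KenigMerle2006 (critical-element template), ChangGurskyYang2003 = arXiv:math/0309287 Thms A/B (16π²χ threshold; Bach-flat at equality), ChangQingYang2007 = arXiv:math/0508621 (Bach-flat bubble tree, gap, finiteness), doi:10.2969/jmsj/03730373 (Kobayashi 1985: inf of the Weyl functional as an invariant), doi:10.2307/120996 (Gursky 1998, Weyl functional) + Gursky2000 (Einstein gap on S⁴, vendored as)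

History (route lifecycle, newest last):
- 2026-08-16T04:17:38Z · AUTO-CRUX (backfill): PscSpheresStandard — hypotheses of the deciding theorem that nothing in the route derives are cruxes (operator:999:1085951)
- 2026-08-22T15:47:01Z · DORMANT — reconciler: no traction for 5.5 d (last activity item-evidence-added at 2026-08-17T04:14:07Z); parked, not closed — `ledger route dormant route-SmoothPoincare4- (operator:999:299460)

sub-problem: SmoothPoincare4 · status: dormant · opened planner-plancard-SmoothPoincare4-SmoothPoinca-9f33207c-0 2026-08-15T11:33:14Z · rev 1 · ledger route-SmoothPoincare4-BachCriticalElement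
GENERATED by the gate from the ledger (D-0016/17). Provers cite these decls: `theorem foo : Summit.SmoothPoincare4.SmoothPoincare4.Theses.BachCriticalElement.<Decl> := …` in Summits/SmoothPoincare4/SmoothPoincare4/Theorems/<Name>.lean.
-/

namespace Summit.SmoothPoincare4.SmoothPoincare4.Theses.BachCriticalElement

open scoped BigOperators Topology Manifold Classical MeasureTheory ProbabilityTheory Matrix InnerProductSpace ComplexConjugate ContinuousMap ContDiff
open Filter Set Function TopologicalSpace MeasureTheory

attribute [summit_statement] _root_.SmoothPoincare4

open Literature.SPC4

/-- item stmt-SmoothPoincare4-4393 · crux (kind.auto-crux: conjecture-grade) · rank 0 · open · by planner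
why it might fail: It is SPC4 on Yamabe-positive spheres: false iff an exotic homotopy 4-sphere carries a PSC metric; the programme needs WeylInfimumAttained (no ε-regularity for minimising sequences; no compactness at 𝒲 ≥ 64π²) and a Liouville step containing Einstein uniqueness on S⁴.
sources: ChangGurskyYang2003, ChangQingYang2007, KenigMerle2006, arXiv:math/0404251
[target] every smooth homotopy 4-sphere (summit binder: T2, second countable, C^∞ atlas on ℝ⁴, M ≃ₕ
S⁴) carrying a Riemannian metric with a Levi-Civita connection and everywhere positive scalar
curvature is diffeomorphic to S⁴ — the deliverable X₁ of the critical-element programme (card cruxes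
E + R), the node that the two-layer plan splits into WeylInfimumAttained → WeylMinimiserRigidity
once weylEnergy lands. [deps: EinsteinRigidity, PscOnHomotopySpheres] [difficulty: open-problem] -/
@[route_item "route-SmoothPoincare4-BachCriticalElement", crux]
def PscSpheresStandard : Prop :=
  ∀ (M : Type) [TopologicalSpace M] [T2Space M] [SecondCountableTopology M] [ChartedSpace (EuclideanSpace ℝ (Fin 4)) M] [IsManifold (𝓡 4) ∞ M], M ≃ₕ Metric.sphere (0 : EuclideanSpace ℝ (Fin 5)) 1 → (∃ g : Literature.Geometry.Lorentzian.PseudoRiemannianMetric (𝓡 4) ∞ (EuclideanSpace ℝ (Fin 4)) (TangentSpace (𝓡 4) : M → Type _), ∃ _ : g.HasLeviCivita, g.IsRiemannian ∧ ∀ x, 0 < g.scalarCurvature x) → Nonempty (M ≃ₘ⟮𝓡 4, 𝓡 4⟯ Metric.sphere (0 : EuclideanSpace ℝ (Fin 5)) 1)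

/-- item stmt-SmoothPoincare4-4394 · crux · rank 2 · open · by planner
why it might fail: It contains uniqueness of the round Einstein metric on S⁴ (Besse1987 §0.32: no manifold, not even S⁴, is known to carry exactly one Einstein structure); Böhm built non-round Einstein metrics on S⁵–S⁹ (Bohm1998); one non-round Λ>0 Einstein metric on S⁴ refutes it without touching SPC4.
sources: Besse1987, Bohm1998, Gursky2000, Brendle2010, MicallefWang1993, doi:10.1007/s002220000097
[crux] the Einstein base case of the Liouville step (card crux R restricted to Einstein metrics,
which are Bach-flat and Yamabe-positive when Λ > 0): on a smooth homotopy 4-sphere M, every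
Riemannian metric g with Levi-Civita connection and Ric_g = Λ·g for some Λ > 0 is locally
conformally flat (hence, by Kuiper — proved in tree — M ≅ S⁴ and g has constant curvature). Known
rungs: W⁺ ≡ 0 (Hitchin, Besse1987 13.30), nonnegative isotropic curvature (MicallefWang1993,
Brendle2010), sectional-curvature pinching (Yang 2000 doi:10.1007/s002220000097, Cui–Sun
doi:10.1007/s00229-020-01217-y), W⁺ small with the sphere's Einstein constant (Gursky2000), and
local rigidity of the round metric (Koiso, Besse1987 12.H). [difficulty: open-problem] -/
@[route_item "route-SmoothPoincare4-BachCriticalElement"]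
def EinsteinRigidity : Prop :=
  ∀ (M : Type) [TopologicalSpace M] [T2Space M] [SecondCountableTopology M] [ChartedSpace (EuclideanSpace ℝ (Fin 4)) M] [IsManifold (𝓡 4) ∞ M], M ≃ₕ Metric.sphere (0 : EuclideanSpace ℝ (Fin 5)) 1 → ∀ (g : Literature.Geometry.Lorentzian.PseudoRiemannianMetric (𝓡 4) ∞ (EuclideanSpace ℝ (Fin 4)) (TangentSpace (𝓡 4) : M → Type _)) [g.HasLeviCivita], g.IsRiemannian → ∀ Λ : ℝ, 0 < Λ → (∀ x, g.ricci x = Λ • g.toBilinForm x) → g.IsLocallyConformallyFlat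

/-- item stmt-SmoothPoincare4-4395 · crux · rank 3 · open · by planner
why it might fail: PSC on a GIVEN smooth homotopy 4-sphere is open: Gromov–Lawson/Stolz give PSC in dim 4 only up to homeomorphism (KumarSen2025 Obs. 9); Σ comes from S⁴ by codimension-2 surgeries where PSC surgery fails; an exotic Σ may carry an unknown obstruction.
sources: KumarSen2025, arXiv:2501.01113, Hoelzel2016, SchoenYau1979, Hamilton1997
[crux] every smooth homotopy 4-sphere (summit binder) carries a Riemannian metric with a Levi-Civita
connection and everywhere positive scalar curvature (card crux P; the same content as route PIC's
PicPscV2, stmt-SmoothPoincare4-0442, restated with the summit binder M ≃ₕ S⁴ instead of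
`HomotopySphere 4` so that no fact-bearing topology file enters this route's import cone). Without
it the programme proves X₁ only; its refutation refutes SPC4. [difficulty: open-problem] -/
@[route_item "route-SmoothPoincare4-BachCriticalElement", crux]
def PscOnHomotopySpheres : Prop :=
  ∀ (M : Type) [TopologicalSpace M] [T2Space M] [SecondCountableTopology M] [ChartedSpace (EuclideanSpace ℝ (Fin 4)) M] [IsManifold (𝓡 4) ∞ M], M ≃ₕ Metric.sphere (0 : EuclideanSpace ℝ (Fin 5)) 1 → ∃ g : Literature.Geometry.Lorentzian.PseudoRiemannianMetric (𝓡 4) ∞ (EuclideanSpace ℝ (Fin 4)) (TangentSpace (𝓡 4) : M → Type _), ∃ _ : g.HasLeviCivita, g.IsRiemannian ∧ ∀ x, 0 < g.scalarCurvature x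

/-- item stmt-SmoothPoincare4-5104 · support · rank 4 · open · by planner
[crux] WeylMinimiserRigidity — the Kenig–Merle LIOUVILLE STEP in minimal form (card
bach-critical-element, crux R restricted to global minimisers; informal until the definition
`weylEnergy` lands: definition request defn-weylEnergy, topic Literature/Geometry/Riemannian; type
it with the SUMMIT BINDER, not `HomotopySphere 4`, for cone hygiene). Statement: on a smooth
homotopy 4-sphere M, a Riemannian metric g with Levi-Civita connection and scal_g > 0 everywhere
that MINIMISES the Weyl energy 𝒲[g] = ∫_M |W_g|² dvol_g (|W|² = W_ijkl W^ijkl, the (0,4)-norm of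
ChangGurskyYang2003 Remark 2) among all such PSC metrics on M is locally conformally flat (hence M ≅
S⁴ by Kuiper, PROVED in tree: Literature.Geometry.Riemannian.kuiper_holds /
kuiper_conformallyFlat_sphere_four_holds). Intended signature once defn-weylEnergy lands
(g.weylEnergy : ℝ≥0∞): ∀ (M : Type) [TopologicalSpace M] [T2Space M] [SecondCountableTopology M]
[ChartedSpace (EuclideanSpace ℝ (Fin 4)) M] [IsManifold (𝓡 4) ∞ M], M ≃ₕ Metric.sphere (0 :
EuclideanSpace ℝ (Fin 5)) 1 → ∀ (g : Literature.Geometry.Lorentzian.PseudoRiemannianMetric (𝓡 4) ∞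
(EuclideanSpace ℝ (Fin 4)) (TangentSpace (𝓡 4) : M → Type _)) [g.HasLeviCivita], g. -/
@[route_item "route-SmoothPoincare4-BachCriticalElement"]
def WeylMinimiserRigidity : Prop :=
  ∀ (M : Type) [TopologicalSpace M] [T2Space M] [SecondCountableTopology M] [ChartedSpace (EuclideanSpace ℝ (Fin 4)) M] [IsManifold (𝓡 4) ∞ M], M ≃ₕ Metric.sphere (0 : EuclideanSpace ℝ (Fin 5)) 1 → ∀ (g : Literature.Geometry.Lorentzian.PseudoRiemannianMetric (𝓡 4) ∞ (EuclideanSpace ℝ (Fin 4)) (TangentSpace (𝓡 4) : M → Type _)) [g.HasLeviCivita], g.IsRiemannian → (∀ x, 0 < g.scalarCurvature x) → (∀ (g' : Literature.Geometry.Lorentzian.PseudoRiemannianMetric (𝓡 4) ∞ (EuclideanSpace ℝ (Fin 4)) (TangentSpace (𝓡 4) : M → Type _)) [g'.HasLeviCivita], g'.IsRiemannian → (∀ x, 0 < g'.scalarCurvature x) → g.weylEnergy ≤ g'.weylEnergy) → g.IsLocallyConformallyFlat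

/-- item stmt-SmoothPoincare4-5154 · support · rank 5 · open · by planner
[crux] WeylInfimumAttained — EXISTENCE OF THE CRITICAL ELEMENT, no-bubbling form (card
bach-critical-element, crux E; informal until the definition `weylEnergy` lands: definition request
defn-weylEnergy; type it with the SUMMIT BINDER for cone hygiene). Statement: on a smooth homotopy
4-sphere M that carries a Riemannian metric with Levi-Civita connection and everywhere positive
scalar curvature, the infimum of the Weyl energy 𝒲[g] = ∫_M |W_g|² dvol_g ((0,4)-norm) over all such
PSC metrics is ATTAINED by one of them. Intended signature once defn-weylEnergy lands (g.weylEnergy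
: ℝ≥0∞): ∀ (M : Type) [TopologicalSpace M] [T2Space M] [SecondCountableTopology M] [ChartedSpace
(EuclideanSpace ℝ (Fin 4)) M] [IsManifold (𝓡 4) ∞ M], M ≃ₕ Metric.sphere (0 : EuclideanSpace ℝ (Fin
5)) 1 → (∃ g : Literature.Geometry.Lorentzian.PseudoRiemannianMetric (𝓡 4) ∞ (EuclideanSpace ℝ (Fin
4)) (TangentSpace (𝓡 4) : M → Type _), ∃ _ : g.HasLeviCivita, g.IsRiemannian ∧ ∀ x, 0 <
g.scalarCurvature x) → ∃ g : Literature.Geometry.Lorentzian.PseudoRiemannianMetric (𝓡 4) ∞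
(EuclideanSpace ℝ (Fin 4)) (TangentSpace (𝓡 4) : M → Type _), ∃ _ : g.HasLeviCivita, g.IsRiemannian
∧ (∀ x, 0 < g.scalarCurvature x) ∧ ∀ (g' -/
@[route_item "route-SmoothPoincare4-BachCriticalElement"]
def WeylInfimumAttained : Prop :=
  ∀ (M : Type) [TopologicalSpace M] [T2Space M] [SecondCountableTopology M] [ChartedSpace (EuclideanSpace ℝ (Fin 4)) M] [IsManifold (𝓡 4) ∞ M], M ≃ₕ Metric.sphere (0 : EuclideanSpace ℝ (Fin 5)) 1 → (∃ g : Literature.Geometry.Lorentzian.PseudoRiemannianMetric (𝓡 4) ∞ (EuclideanSpace ℝ (Fin 4)) (TangentSpace (𝓡 4) : M → Type _), ∃ _ : g.HasLeviCivita, g.IsRiemannian ∧ ∀ x, 0 < g.scalarCurvature x) → ∃ g : Literature.Geometry.Lorentzian.PseudoRiemannianMetric (𝓡 4) ∞ (EuclideanSpace ℝ (Fin 4)) (TangentSpace (𝓡 4) : M → Type _), ∃ _ : g.HasLeviCivita, g.IsRiemannian ∧ (∀ x, 0 < g.scalarCurvature x) ∧ ∀ (g' : Literature.Geometry.Lorentzian.PseudoRiemannianMetric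 (𝓡 4) ∞ (EuclideanSpace ℝ (Fin 4)) (TangentSpace (𝓡 4) : M → Type _)) [g'.HasLeviCivita], g'.IsRiemannian → (∀ x, 0 < g'.scalarCurvature x) → g.weylEnergy ≤ g'.weylEnergy

/-- item stmt-SmoothPoincare4-4396 · support · rank 9 · open · by planner
sources: Kuiper1949, Besse1987, HatcherAT2002
[support] glue for the Einstein rung, provable now: EinsteinRigidity implies that a smooth homotopy
4-sphere carrying a Λ>0 Einstein metric is diffeomorphic to S⁴ — from compactness
(Literature.Topology.FourManifolds.compactSpace_of_homotopyEquiv_sphere_four_holds) and simple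
connectivity (simplyConnectedSpace_of_homotopyEquiv_sphere_four with
simplyConnectedSpace_sphere_four_holds) of M ≃ₕ S⁴ and Kuiper's theorem in dimension 4
(Literature.Geometry.Riemannian.kuiper_four applied to kuiper_holds), ≈ 10 lines in a Theorems file
importing those proof files. [difficulty: provable-now] -/
@[route_item "route-SmoothPoincare4-BachCriticalElement"]
def EinsteinSpheresStandard : Prop :=
  EinsteinRigidity → ∀ (M : Type) [TopologicalSpace M] [T2Space M] [SecondCountableTopology M] [ChartedSpace (EuclideanSpace ℝ (Fin 4)) M] [IsManifold (𝓡 4) ∞ M], M ≃ₕ Metric.sphere (0 : EuclideanSpace ℝ (Fin 5)) 1 → ∀ (g : Literature.Geometry.Lorentzian.PseudoRiemannianMetric (𝓡 4) ∞ (EuclideanSpace ℝ (Fin 4)) (TangentSpace (𝓡 4) : M → Type _)) [g.HasLeviCivita], g.IsRiemannian → ∀ Λ : ℝ, 0 < Λ → (∀ x, g.ricci x = Λ • g.toBilinForm x) → Nonempty (M ≃ₘ⟮𝓡 4, 𝓡 4⟯ Metric.sphere (0 : EuclideanSpace ℝ (Fin 5)) 1)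

/-- item stmt-SmoothPoincare4-4397 · assembly · rank 1 · open · by planner
sources: Kirby1997, ChangGurskyYang2003
[assembly] PscOnHomotopySpheres → PscSpheresStandard → SmoothPoincare4 (P, then the target X₁, then
the summit statement; provable now). -/
@[route_item "route-SmoothPoincare4-BachCriticalElement"]
def Assembly : Prop :=
  PscOnHomotopySpheres → PscSpheresStandard → SmoothPoincare4

/-! D-0027 §2.1 — DECIDING THEOREM (planner-authored via `route open/edit --closes-file`; by planner-rbadge-SmoothPoincare4-BachCriticalEle-623dfcb1-g4-0 2026-08-15T16:10:22Z):
its hypotheses are this route's items and its conclusion the sub-problem Statement (glue_lint), and it elaborates with this file. -/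

@[closes "route-SmoothPoincare4-BachCriticalElement"] theorem closes (hP : PscOnHomotopySpheres) (hS : PscSpheresStandard) :
    _root_.SmoothPoincare4 := by
  intro M _ _ _ _ _ e
  exact hS M e (hP M e)

end Summit.SmoothPoincare4.SmoothPoincare4.Theses.BachCriticalElement
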